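import Summits.QuantumAdvantage.QuantumAdvantage.Theorems.CubicForrelationNearExactIsExactTwelveLevelSixGammaLine
import Summits.QuantumAdvantage.QuantumAdvantage.Theorems.CubicForrelationNearExactIsExactTwelveLevelSixGammaRank
import Summits.QuantumAdvantage.QuantumAdvantage.Theorems.CubicForrelationNearExactIsExactTwelveLevelSixGammaFlatKill
import Summits.QuantumAdvantage.QuantumAdvantage.Theorems.CubicForrelationNearExactIsExactTwelveBoundary2932Reduction2

/-!
# Crux `CubicForrelation.NearExactIsExact` (stmt-QuantumAdvantage-14043) — n = 12 AT `Φ = 29/32`: configuration (γ) is DEAD;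
  a cubic pair with `29/32 ≤ Φ < 1` has BOTH sides in configuration (β) (`#Z = 768`, `e = ±1` on `Z`, `e = 0` off `Z`)

Certificate seat `b2b-cforr-cert` (gen 25).  HONEST FRAMING: kernel-checked finite-slice theorems (standard axioms) about cubic Boolean pairs
on 12 bits.  They do NOT decide whether `29/32` is a value at `n = 12` — configuration (β) × (β) remains — and claim NO new value of `θ₁₂`
(still `θ₁₂ ∈ [57/64, 29/32]`).  NOT summit progress.  Proof write-up: HOME/b2b-cforr-cert-g25/PROOF-N12-928-GAMMA.md.

* `tw25_levelSix_gamma_false`: cubic `f, g`, `W_g = 64u''`, `W_f = 64w_f`, `Z = {u'' even}` with `512` points, `Σ e² = 768` with off-`Z`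
  energy `256`, and the partner's even set `{w_f even}` of size `≥ 512` ⇒ `False`.  Assembly: `Z` is a 9-flat (`mw_flat_of_minweight`),
  `e² = 1` on `Z`; `gl_dichotomy`: either `4 ∣ e` off `Z` (dead: `gl_div4_false`) or the bad set is a 6-flat `m₀ ⊕ U` carrying `e = ±2`
  (`gl_M_flat`); then `gr_radical_eq_eight` forces rank `6` and `gf_rank_six_false` kills rank `6`.
* `tw25_boundary_reduction3` (+ `_symm`): for cubic `f, g` with `29/32 ≤ Φ(f,g) < 1`: `Φ = 29/32`, `W_g = 64u''`, `Z = {u'' even}` has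
  exactly `768` points, `(u'' − (−1)^f)² = 1` on `Z` and `u'' = (−1)^f` off `Z`; and the same for `f` against `g`.
What is left for "is `29/32` a value at `n = 12`": (β) × (β) — two weight-768 cubic supports (Kasami–Tokura words) with signs whose Fourier
transforms are `64 ×` each other (HOME/b2b-cforr-cert-g23/PLAN-N12-928-L6.md, pointers `to15_weight768_hyperplane`, `to15_weight768_l1`).

References: T. Kasami, N. Tokura, IEEE Trans. Inform. Theory IT-16 (1970); MacWilliams–Sloane (1977) Ch. 13, Ch. 15; R. O'Donnell (2014)
§1.4.  Axioms: the standard three.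
-/

set_option linter.dupNamespace false -- D-0017: single-problem summit ⇒ `QuantumAdvantage.QuantumAdvantage` by design

noncomputable section

namespace Summit.QuantumAdvantage.QuantumAdvantage.Theorems.CubicForrelation.NearExactIsExact

open Finset
open Literature.Computability.QuantumComplexity
open Literature.Computability.QuantumComplexity.BuzetChailloux (bxor zeroVec bxor_bxor_cancel_left bxor_zeroVec zeroVec_bxor bxor_comm
  bxor_self)
open Literature.Computability.QuantumComplexity.DerivativeWalsh (W)

/-! ### Configuration (γ) is dead -/

/-- **Configuration (γ) at `Φ = 29/32` on 12 bits is impossible.**  Cubic `f, g`, `W_g = 64u''`, `W_f = 64w_f`, `#{u'' even} = 512`,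
`Σ (u'' − (−1)^f)² = 768` of which `256` off `{u'' even}`, and `#{w_f even} ≥ 512` ⇒ `False`.  NOT summit progress. [this work] -/
theorem tw25_levelSix_gamma_false (f g : (Fin (6 + 6) → Bool) → Bool) (hf : IsDegLeFun 3 f) (hg : IsDegLeFun 3 g)
    (u'' : (Fin (6 + 6) → Bool) → ℤ) (hu'' : ∀ x, W (fun y => signOf (g y)) x = (2 : ℝ) ^ 6 * (u'' x : ℝ))
    (h512 : #(univ.filter fun x : Fin (6 + 6) → Bool => ¬ Odd (u'' x)) = 512)
    (hB : (∑ x, (u'' x - sZ (f x)) ^ 2 : ℤ) = 768)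
    (hoff : ∑ x ∈ univ.filter (fun x => x ∉ (univ.filter fun x : Fin (6 + 6) → Bool => ¬ Odd (u'' x))), (u'' x - sZ (f x)) ^ 2 = 256)
    (wf : (Fin (6 + 6) → Bool) → ℤ) (hwf : ∀ y, W (fun x => signOf (f x)) y = (2 : ℝ) ^ 6 * (wf y : ℝ))
    (hZf : 512 ≤ #(univ.filter fun y : Fin (6 + 6) → Bool => ¬ Odd (wf y))) : False := by
  classical
  set Z := (univ.filter fun x : Fin (6 + 6) → Bool => ¬ Odd (u'' x)) with hZdef
  have hmemZ : ∀ x, x ∈ Z ↔ ¬ Odd (u'' x) := fun x => by simp [hZdef]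
  set e : (Fin (6 + 6) → Bool) → ℤ := fun x => u'' x - sZ (f x) with hedef
  change (∑ x, e x ^ 2 : ℤ) = 768 at hB
  change ∑ x ∈ univ.filter (fun x => x ∉ Z), e x ^ 2 = 256 at hoff
  -- the 9-flat
  obtain ⟨xZ, hxZ⟩ : Z.Nonempty := card_pos.1 (by rw [h512]; norm_num)
  have hp : IsDegLeFun 3 (fun x => decide (Odd (u'' x))) :=
    stub_walshTower stub_axParity (6 + 6) 6 3 g u'' hg hu'' (by intro k hk hkn; omega)
  have hp' : IsDegLeFun (2 + 1) (fun x => decide (Odd (u'' x)) ^^ true) := tb_isDegLeFun_xor_const hp true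
  have hfilt : (univ.filter fun x : Fin (6 + 6) → Bool => (decide (Odd (u'' x)) ^^ true) = true) = Z :=
    filter_congr fun x _ => by simp
  have hmw := mw_flat_of_minweight 2 (fun x => decide (Odd (u'' x)) ^^ true) hp' (by rw [hfilt, h512]; norm_num)
  rw [hfilt] at hmw
  obtain ⟨h0, hadd, hcardV, hcoset⟩ := hmw
  set V₀ := univ.filter (fun a : Fin (6 + 6) → Bool => ∀ x,
    (decide (Odd (u'' (bxor x a))) ^^ true) = (decide (Odd (u'' x)) ^^ true)) with hV₀
  have hS : Z = V₀.image (bxor xZ) := hcoset xZ (by have h := (hmemZ xZ).1 hxZ; simpa using h)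
  rw [h512] at hcardV
  -- `e² = 1` on `Z`
  have heodd : ∀ x, x ∈ Z → Odd (e x) := by
    intro x hx
    have hev := Int.not_odd_iff_even.1 ((hmemZ x).1 hx)
    rcases tp_sZ_cases (f x) with hs | hs <;> simp only [e] <;> rw [hs]
    · exact Int.odd_sub.2 (iff_of_false (Int.not_odd_iff_even.2 hev) (by decide))
    · exact Int.odd_sub.2 (iff_of_false (Int.not_odd_iff_even.2 hev) (by decide))
  have hZsum : ∑ x ∈ Z, e x ^ 2 = 512 := by
    have hsplit : (∑ x, e x ^ 2 : ℤ) = ∑ x ∈ Z, e x ^ 2 + ∑ x ∈ univ.filter (fun x => x ∉ Z), e x ^ 2 := by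
      rw [← sum_filter_add_sum_filter_not univ (fun x => x ∈ Z)]
      congr 1
      exact sum_congr (by ext x; simp) fun _ _ => rfl
    linarith
  have hZ1 : ∀ x ∈ Z, (u'' x - sZ (f x)) ^ 2 = 1 := by
    have hlb : ∀ x ∈ Z, (1 : ℤ) ≤ e x ^ 2 := by
      intro x hx
      have h0' := Int.odd_iff.1 (heodd x hx)
      have : e x ≤ -1 ∨ 1 ≤ e x := by omega
      rcases this with h | h <;> nlinarith
    have hz : ∑ x ∈ Z, (e x ^ 2 - 1) = 0 := by
      rw [sum_sub_distrib, sum_const, nsmul_eq_mul, h512, hZsum]; norm_num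
    intro x hx
    have := (sum_eq_zero_iff_of_nonneg fun x hx => by linarith [hlb x hx]).1 hz x hx
    show e x ^ 2 = 1
    linarith
  -- the sign `hb`
  set hb : (Fin (6 + 6) → Bool) → Bool := fun x => decide (e x = -1) with hhbdef
  have hhb : ∀ x ∈ Z, sZ (hb x) = u'' x - sZ (f x) := by
    intro x hx
    have h1 : e x ^ 2 = 1 := hZ1 x hx
    have h2 : (e x - 1) * (e x + 1) = 0 := by nlinarith
    show sZ (hb x) = e x
    rcases mul_eq_zero.1 h2 with h | h
    · have : e x = 1 := by linarith
      simp only [hb, this]; decide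
    · have : e x = -1 := by linarith
      simp only [hb, this]; decide
  -- the dichotomy
  rcases gl_dichotomy f g hf hg u'' hu'' V₀ xZ h0 hadd hcardV hS hoff.le with h4 | ⟨c, hc, hM64, hMsub, hM4, hM0⟩
  · exact gl_div4_false f g hf hg u'' hu'' V₀ xZ h0 hadd hcardV hS hZ1 hoff h4 wf hwf
  set M := (V₀.image (bxor c)).filter (fun y => ¬ (4 : ℤ) ∣ u'' y - sZ (f y)) with hMdef
  obtain ⟨hU0, hUadd, hUcard, hMcos⟩ := gl_M_flat f g hf hg u'' hu'' V₀ xZ h0 hadd hcardV hS hoff.le c hc hM64 hM4 hM0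
  set U := V₀.filter (fun a => ∀ x ∈ M, bxor x a ∈ M) with hUdef
  have hUV : U ⊆ V₀ := filter_subset _ _
  obtain ⟨m₀, hm₀⟩ : M.Nonempty := card_pos.1 (by rw [hM64]; norm_num)
  have hm₀Z : m₀ ∉ Z := by
    obtain ⟨v, hv, hveq⟩ := mem_image.1 (mem_filter.1 hm₀).1
    rw [← hveq]
    exact fl1_coset_out' hadd hS hc hv
  have hMU : M = U.image (bxor m₀) := hMcos m₀ hm₀
  -- `Σ_{off Z} |e| ≤ 128`
  have hl1 : ∑ y ∈ univ.filter (fun y => y ∉ Z), |(u'' y - sZ (f y))| ≤ 128 := by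
    have hpt : ∀ y ∈ univ.filter (fun y : Fin (6 + 6) → Bool => y ∉ Z), |e y| = if y ∈ M then (2 : ℤ) else 0 := by
      intro y hy
      have hyZ : y ∉ Z := (mem_filter.1 hy).2
      by_cases hyM : y ∈ M
      · rw [if_pos hyM]
        have h4' : e y ^ 2 = 4 := hM4 y hyM
        have : (|e y| - 2) * (|e y| + 2) = 0 := by nlinarith [sq_abs (e y), abs_nonneg (e y)]
        rcases mul_eq_zero.1 this with h | h
        · linarith
        · linarith [abs_nonneg (e y)]
      · rw [if_neg hyM]
        have : e y = 0 := hM0 y hyZ hyM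
        rw [this]; simp
    rw [sum_congr rfl hpt, ← sum_filter, sum_const, nsmul_eq_mul]
    have hsub : ((univ.filter fun y : Fin (6 + 6) → Bool => y ∉ Z).filter fun y => y ∈ M) ⊆ M := fun y hy => (mem_filter.1 hy).2
    have := card_le_card hsub
    rw [hM64] at this
    have : (#((univ.filter fun y : Fin (6 + 6) → Bool => y ∉ Z).filter fun y => y ∈ M) : ℤ) ≤ 64 := by exact_mod_cast this
    linarith
  -- rank 6 is forced, and rank 6 is dead
  have hR8 := gr_radical_eq_eight f g hf hg u'' hu'' V₀ xZ h0 hadd hcardV hS hb hhb hl1 hoff wf hwf hZf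
  have hM0' : ∀ y, y ∉ Z → y ∉ U.image (bxor m₀) → u'' y - sZ (f y) = 0 := by
    intro y hy hyU
    rw [← hMU] at hyU
    exact hM0 y hy hyU
  exact gf_rank_six_false f g hf hg u'' hu'' V₀ xZ h0 hadd hcardV hS hoff.le hb hhb U hUV hU0 hUadd hUcard m₀ hm₀Z hM0' hR8

/-! ### Both sides are in configuration (β) -/

/-- **Boundary reduction at `29/32`, third form (12 bits)**: for cubic `f, g` with `29/32 ≤ Φ(f,g) < 1` there is `u''` with `W_g = 64u''`,
`Φ = 29/32`, `Σ (u'' − (−1)^f)² = 768`, `Z = {u'' even}` has exactly `768` points, `(u'' − (−1)^f)² = 1` on `Z` and `u'' = (−1)^f`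
off `Z` (configuration (β)).  It does NOT decide whether `29/32` is a value.  NOT summit progress. [this work] -/
theorem tw25_boundary_reduction3 (f g : (Fin (6 + 6) → Bool) → Bool) (hf : IsDegLeFun 3 f) (hg : IsDegLeFun 3 g)
    (hΦ : (29 / 32 : ℝ) ≤ forrelation f g) (hhi : forrelation f g < 1) :
    ∃ u'' : (Fin (6 + 6) → Bool) → ℤ, (∀ x, W (fun y => signOf (g y)) x = (2 : ℝ) ^ 6 * (u'' x : ℝ)) ∧
      forrelation f g = 29 / 32 ∧ (∑ x, (u'' x - sZ (f x)) ^ 2 : ℤ) = 768 ∧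
      #(univ.filter fun x : Fin (6 + 6) → Bool => ¬ Odd (u'' x)) = 768 ∧
      (∀ x ∈ (univ.filter fun x : Fin (6 + 6) → Bool => ¬ Odd (u'' x)), (u'' x - sZ (f x)) ^ 2 = 1) ∧
      (∀ y, y ∉ (univ.filter fun x : Fin (6 + 6) → Bool => ¬ Odd (u'' x)) → u'' y - sZ (f y) = 0) := by
  classical
  obtain ⟨u'', hu'', hΦeq, hB, hβγ⟩ := tw23_boundary_reduction2 f g hf hg hΦ hhi
  -- the partner: level 6 with an even set of `≥ 512` points
  obtain ⟨-, ⟨wf, hwf⟩⟩ := tw23_ge2932_levelSix f g hf hg hΦ hhi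
  obtain ⟨wf', hwf', -, -, hβγ'⟩ := tw23_boundary_reduction2_symm f g hf hg hΦ hhi
  have hww : ∀ y, wf y = wf' y := by
    intro y
    have h := hwf y
    rw [hwf' y] at h
    have : ((wf' y : ℤ) : ℝ) = ((wf y : ℤ) : ℝ) := by
      have h2 : (2 : ℝ) ^ 6 ≠ 0 := by positivity
      exact mul_left_cancel₀ h2 h
    exact_mod_cast this.symm
  have hZf : 512 ≤ #(univ.filter fun y : Fin (6 + 6) → Bool => ¬ Odd (wf y)) := by
    have e1 : (univ.filter fun y : Fin (6 + 6) → Bool => ¬ Odd (wf y)) = univ.filter fun y : Fin (6 + 6) → Bool => ¬ Odd (wf' y) :=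
      filter_congr fun y _ => by rw [hww y]
    rw [e1]
    rcases hβγ' with h | ⟨h, -⟩ <;> omega
  set Z := (univ.filter fun x : Fin (6 + 6) → Bool => ¬ Odd (u'' x)) with hZdef
  have hmemZ : ∀ x, x ∈ Z ↔ ¬ Odd (u'' x) := fun x => by simp [hZdef]
  rcases hβγ with h768 | ⟨h512, hoff⟩
  swap
  · exact (tw25_levelSix_gamma_false f g hf hg u'' hu'' h512 hB hoff wf hwf hZf).elim
  refine ⟨u'', hu'', hΦeq, hB, h768, ?_⟩
  -- (β): `e² = 1` on `Z` and `e = 0` off `Z` (budget `768 = #Z`)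
  set e : (Fin (6 + 6) → Bool) → ℤ := fun x => u'' x - sZ (f x) with hedef
  change (∑ x, e x ^ 2 : ℤ) = 768 at hB
  have heodd : ∀ x, x ∈ Z → Odd (e x) := by
    intro x hx
    have hev := Int.not_odd_iff_even.1 ((hmemZ x).1 hx)
    rcases tp_sZ_cases (f x) with hs | hs <;> simp only [e] <;> rw [hs]
    · exact Int.odd_sub.2 (iff_of_false (Int.not_odd_iff_even.2 hev) (by decide))
    · exact Int.odd_sub.2 (iff_of_false (Int.not_odd_iff_even.2 hev) (by decide))
  have hlb : ∀ x, (if x ∈ Z then (1 : ℤ) else 0) ≤ e x ^ 2 := by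
    intro x
    split_ifs with hx
    · have h0' := Int.odd_iff.1 (heodd x hx)
      have : e x ≤ -1 ∨ 1 ≤ e x := by omega
      rcases this with h | h <;> nlinarith
    · exact sq_nonneg _
  have hz : ∑ x, (e x ^ 2 - (if x ∈ Z then (1 : ℤ) else 0)) = 0 := by
    rw [sum_sub_distrib, hB, ← sum_filter, sum_const, nsmul_eq_mul, mul_one]
    have ef : univ.filter (fun x => x ∈ Z) = Z := by ext x; simp
    rw [ef, h768]; norm_num
  have htight : ∀ x, e x ^ 2 = if x ∈ Z then (1 : ℤ) else 0 := by
    intro x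
    have := (sum_eq_zero_iff_of_nonneg fun x _ => by linarith [hlb x]).1 hz x (mem_univ _)
    linarith
  refine ⟨fun x hx => ?_, fun y hy => ?_⟩
  · have := htight x; rw [if_pos hx] at this; exact this
  · have := htight y; rw [if_neg hy] at this
    exact pow_eq_zero_iff two_ne_zero |>.1 this

/-- **Symmetric form** (`Φ(g,f) = Φ(f,g)`): the `f`-side is in configuration (β) as well. NOT summit progress. [this work] -/
theorem tw25_boundary_reduction3_symm (f g : (Fin (6 + 6) → Bool) → Bool) (hf : IsDegLeFun 3 f) (hg : IsDegLeFun 3 g)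
    (hΦ : (29 / 32 : ℝ) ≤ forrelation f g) (hhi : forrelation f g < 1) :
    ∃ wf : (Fin (6 + 6) → Bool) → ℤ, (∀ y, W (fun x => signOf (f x)) y = (2 : ℝ) ^ 6 * (wf y : ℝ)) ∧
      forrelation g f = 29 / 32 ∧ (∑ y, (wf y - sZ (g y)) ^ 2 : ℤ) = 768 ∧
      #(univ.filter fun y : Fin (6 + 6) → Bool => ¬ Odd (wf y)) = 768 ∧
      (∀ y ∈ (univ.filter fun y : Fin (6 + 6) → Bool => ¬ Odd (wf y)), (wf y - sZ (g y)) ^ 2 = 1) ∧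
      (∀ x, x ∉ (univ.filter fun y : Fin (6 + 6) → Bool => ¬ Odd (wf y)) → wf x - sZ (g x) = 0) := by
  have hΦ' : forrelation g f = forrelation f g := by
    rw [Summit.QuantumAdvantage.QuantumAdvantage.Theorems.SignedCubicForrelationNotPrBPP.Negative.HalfQuad.forrelation_comm]
  exact tw25_boundary_reduction3 g f hg hf (by rw [hΦ']; exact hΦ) (by rw [hΦ']; exact hhi)

end Summit.QuantumAdvantage.QuantumAdvantage.Theorems.CubicForrelation.NearExactIsExact

end
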